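import Summits.Ventures.PercRepro.C025ProfilePLDResidual

/-!
# THE BAD-SOURCE HOOK: `#RS ≤ #THI` FROM AN INJECTION OF THE BAD RESIDUAL SOURCES (night-3 g28)

`proofs/NIGHT3-G28-PAVING.md` §3(b).  The residual sources split into the GOOD ones (`ρ(I ∪ D) = ρ(I) + δ`), whose
natural images `(E ∖ (I ∪ D), D)` are distinct high pairs (`natural_injOn`, `natural_image_mem_high_of_good`),
and the BAD ones.  So `#RS ≤ #THI` — hence (PLD) by `pld_of_card_residual_le` — follows from ANY injection of the bad
residual sources into the SPARE high pairs, those not hit by a good source (`card_residual_le_of_bad_inj`,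
`pld_of_bad_inj`).  A paving matroid has no bad source (`PavingPLD.pld_of_paving`); the census of the paper (all
2,198 matroids on ≤ 8 elements, 104,523 bad sources) finds such injections inside the relation «same `D`, and
`E ∖ J ⊇ I ∪ D` or `J ⊇ I`» on every instance — the shape of the general rule.
No `def`, no `instance`, no notation.  Axioms: standard.
-/

open scoped Matroid

namespace PercRepro

open Finset ThmH

namespace PavingPLD

variable {α : Type} [DecidableEq α]

/-- The natural map `(I, D) ↦ (E ∖ (I ∪ D), D)` is injective on pairs with `I ⊆ E` and `D ⊆ K(E ∖ I)`. -/
theorem natural_injOn (M : Matroid α) [M.Finite] (K : Finset α → Finset α)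
    (hK : ∀ X, K X ⊆ X ∧ M.Indep (K X : Set α) ∧ (K X).card = (M.eRk (X : Set α)).toNat)
    (s : Finset (Finset α)) (hs : s ⊆ (gr M).powerset) (δ : ℕ) :
    Set.InjOn (fun p : (Σ _ : Finset α, Finset α) => (⟨gr M \ (p.1 ∪ p.2), p.2⟩ : Σ _ : Finset α, Finset α))
      ((s.sigma (fun I : Finset α => powersetCard δ (K (gr M \ I)))) : Set (Σ _ : Finset α, Finset α)) := by
  intro p hp q hq hpq
  rw [mem_coe, mem_sigma, mem_powersetCard] at hp hq
  obtain ⟨hIp, hDp⟩ := hp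
  obtain ⟨hIq, hDq⟩ := hq
  have hIp' : p.1 ⊆ gr M := mem_powerset.1 (hs hIp)
  have hIq' : q.1 ⊆ gr M := mem_powerset.1 (hs hIq)
  have hDpE : p.2 ⊆ gr M \ p.1 := hDp.1.trans (hK _).1
  have hDqE : q.2 ⊆ gr M \ q.1 := hDq.1.trans (hK _).1
  have hUp : p.1 ∪ p.2 ⊆ gr M := union_subset hIp' (hDpE.trans sdiff_subset)
  have hUq : q.1 ∪ q.2 ⊆ gr M := union_subset hIq' (hDqE.trans sdiff_subset)
  simp only [Sigma.mk.inj_iff, heq_eq_eq] at hpq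
  obtain ⟨h1, h2⟩ := hpq
  have h3 : p.1 ∪ p.2 = q.1 ∪ q.2 := by
    rw [← Finset.sdiff_sdiff_eq_self hUp, ← Finset.sdiff_sdiff_eq_self hUq, h1]
  have h4 : p.1 = q.1 := by
    have hp' : p.1 = (p.1 ∪ p.2) \ p.2 :=
      (union_sdiff_cancel_right (disjoint_of_subset_right hDpE sdiff_disjoint.symm)).symm
    have hq' : q.1 = (q.1 ∪ q.2) \ q.2 :=
      (union_sdiff_cancel_right (disjoint_of_subset_right hDqE sdiff_disjoint.symm)).symm
    rw [hp', hq', h3, h2]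
  exact Sigma.ext h4 (heq_of_eq h2)

/-- **`#RS ≤ #THI` FROM AN INJECTION OF THE BAD SOURCES INTO THE SPARE HIGH PAIRS.**  `RS` is the residual sigma
finset, `THI` the high one; `φ` maps every BAD residual source (`ρ(I ∪ D) ≠ ρ(I) + δ`) to a high pair that is not the
natural image of a good residual source, injectively. -/
theorem card_residual_le_of_bad_inj (M : Matroid α) [M.Finite] (K : Finset α → Finset α)
    (hK : ∀ X, K X ⊆ X ∧ M.Indep (K X : Set α) ∧ (K X).card = (M.eRk (X : Set α)).toNat)
    (lo hi δ : ℕ) (φ : (Σ _ : Finset α, Finset α) → (Σ _ : Finset α, Finset α))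
    (hφ : ∀ p ∈ (((gr M).powerset.filter (fun I : Finset α => lo ≤ (M.eRk (I : Set α)).toNat ∧
        (M.eRk (I : Set α)).toNat ≤ hi ∧ hi + δ + 1 ≤ (M.eRk ((gr M \ I : Finset α) : Set α)).toNat)).sigma
        (fun I : Finset α => powersetCard δ (K (gr M \ I)))).filter
        (fun p => ¬ ((M.eRk ((p.1 ∪ p.2 : Finset α) : Set α)).toNat = (M.eRk (p.1 : Set α)).toNat + δ)),
      φ p ∈ (((gr M).powerset.filter (fun J : Finset α => lo + δ ≤ (M.eRk ((gr M \ J : Finset α) : Set α)).toNat ∧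
        (M.eRk ((gr M \ J : Finset α) : Set α)).toNat ≤ hi + δ ∧ hi + 1 ≤ (M.eRk (J : Set α)).toNat)).sigma
        (fun J : Finset α => powersetCard δ (K (gr M \ J)))) \
        ((((gr M).powerset.filter (fun I : Finset α => lo ≤ (M.eRk (I : Set α)).toNat ∧
        (M.eRk (I : Set α)).toNat ≤ hi ∧ hi + δ + 1 ≤ (M.eRk ((gr M \ I : Finset α) : Set α)).toNat)).sigma
        (fun I : Finset α => powersetCard δ (K (gr M \ I)))).filter
        (fun p => (M.eRk ((p.1 ∪ p.2 : Finset α) : Set α)).toNat = (M.eRk (p.1 : Set α)).toNat + δ)).image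
        (fun p : (Σ _ : Finset α, Finset α) => (⟨gr M \ (p.1 ∪ p.2), p.2⟩ : Σ _ : Finset α, Finset α)))
    (hφinj : Set.InjOn φ ((((gr M).powerset.filter (fun I : Finset α => lo ≤ (M.eRk (I : Set α)).toNat ∧
        (M.eRk (I : Set α)).toNat ≤ hi ∧ hi + δ + 1 ≤ (M.eRk ((gr M \ I : Finset α) : Set α)).toNat)).sigma
        (fun I : Finset α => powersetCard δ (K (gr M \ I)))).filter
        (fun p => ¬ ((M.eRk ((p.1 ∪ p.2 : Finset α) : Set α)).toNat = (M.eRk (p.1 : Set α)).toNat + δ)) :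
        Set (Σ _ : Finset α, Finset α))) :
    (((gr M).powerset.filter (fun I : Finset α => lo ≤ (M.eRk (I : Set α)).toNat ∧
        (M.eRk (I : Set α)).toNat ≤ hi ∧ hi + δ + 1 ≤ (M.eRk ((gr M \ I : Finset α) : Set α)).toNat)).sigma
      (fun I : Finset α => powersetCard δ (K (gr M \ I)))).card ≤
    (((gr M).powerset.filter (fun J : Finset α => lo + δ ≤ (M.eRk ((gr M \ J : Finset α) : Set α)).toNat ∧
        (M.eRk ((gr M \ J : Finset α) : Set α)).toNat ≤ hi + δ ∧ hi + 1 ≤ (M.eRk (J : Set α)).toNat)).sigma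
      (fun J : Finset α => powersetCard δ (K (gr M \ J)))).card := by
  set RS := ((gr M).powerset.filter (fun I : Finset α => lo ≤ (M.eRk (I : Set α)).toNat ∧
      (M.eRk (I : Set α)).toNat ≤ hi ∧ hi + δ + 1 ≤ (M.eRk ((gr M \ I : Finset α) : Set α)).toNat)).sigma
      (fun I : Finset α => powersetCard δ (K (gr M \ I))) with hRS
  set THI := ((gr M).powerset.filter (fun J : Finset α => lo + δ ≤ (M.eRk ((gr M \ J : Finset α) : Set α)).toNat ∧
      (M.eRk ((gr M \ J : Finset α) : Set α)).toNat ≤ hi + δ ∧ hi + 1 ≤ (M.eRk (J : Set α)).toNat)).sigma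
      (fun J : Finset α => powersetCard δ (K (gr M \ J))) with hTHI
  set nat := fun p : (Σ _ : Finset α, Finset α) => (⟨gr M \ (p.1 ∪ p.2), p.2⟩ : Σ _ : Finset α, Finset α) with hnat
  set GOOD := RS.filter (fun p => (M.eRk ((p.1 ∪ p.2 : Finset α) : Set α)).toNat = (M.eRk (p.1 : Set α)).toNat + δ)
    with hGOOD
  set BAD := RS.filter (fun p => ¬ ((M.eRk ((p.1 ∪ p.2 : Finset α) : Set α)).toNat = (M.eRk (p.1 : Set α)).toNat + δ))
    with hBAD
  have hsplit : GOOD.card + BAD.card = RS.card := card_filter_add_card_filter_not _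
  have himg : (GOOD.image nat).card = GOOD.card := by
    apply card_image_of_injOn
    exact Set.InjOn.mono (coe_subset.2 (filter_subset _ _)) (natural_injOn M K hK _ (filter_subset _ _) δ)
  have hsub : GOOD.image nat ⊆ THI := by
    rw [image_subset_iff]
    intro p hp
    rw [hGOOD, mem_filter, hRS, mem_sigma, mem_filter, mem_powerset] at hp
    obtain ⟨⟨⟨hI, hlo, hhi, hf⟩, hD⟩, hgood⟩ := hp
    exact natural_image_mem_high_of_good M K hK hI hlo hhi hf hD hgood
  have hbad : BAD.card ≤ (THI \ GOOD.image nat).card := card_le_card_of_injOn φ (fun p hp => hφ p hp) hφinj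
  have hTHIsplit : (THI \ GOOD.image nat).card + (GOOD.image nat).card = THI.card :=
    card_sdiff_add_card_eq_card hsub
  omega

/-- **(PLD) FROM A BAD-SOURCE INJECTION**, in the bridge's binder: a selector `K` and, at every `(lo, hi, δ)`, an
injection of the bad residual sources into the spare high pairs give `hPLD` of `PLDBridge.rls_disjointSum_freeOn_of_pld`. -/
theorem pld_of_bad_inj (M : Matroid α) [M.Finite] (K : Finset α → Finset α)
    (hK : ∀ X, K X ⊆ X ∧ M.Indep (K X : Set α) ∧ (K X).card = (M.eRk (X : Set α)).toNat)
    (φ : ℕ → ℕ → ℕ → (Σ _ : Finset α, Finset α) → (Σ _ : Finset α, Finset α))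
    (hφ : ∀ lo hi δ : ℕ, ∀ p ∈ (((gr M).powerset.filter (fun I : Finset α => lo ≤ (M.eRk (I : Set α)).toNat ∧
        (M.eRk (I : Set α)).toNat ≤ hi ∧ hi + δ + 1 ≤ (M.eRk ((gr M \ I : Finset α) : Set α)).toNat)).sigma
        (fun I : Finset α => powersetCard δ (K (gr M \ I)))).filter
        (fun p => ¬ ((M.eRk ((p.1 ∪ p.2 : Finset α) : Set α)).toNat = (M.eRk (p.1 : Set α)).toNat + δ)),
      φ lo hi δ p ∈ (((gr M).powerset.filter (fun J : Finset α =>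
        lo + δ ≤ (M.eRk ((gr M \ J : Finset α) : Set α)).toNat ∧
        (M.eRk ((gr M \ J : Finset α) : Set α)).toNat ≤ hi + δ ∧ hi + 1 ≤ (M.eRk (J : Set α)).toNat)).sigma
        (fun J : Finset α => powersetCard δ (K (gr M \ J)))) \
        ((((gr M).powerset.filter (fun I : Finset α => lo ≤ (M.eRk (I : Set α)).toNat ∧
        (M.eRk (I : Set α)).toNat ≤ hi ∧ hi + δ + 1 ≤ (M.eRk ((gr M \ I : Finset α) : Set α)).toNat)).sigma
        (fun I : Finset α => powersetCard δ (K (gr M \ I)))).filter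
        (fun p => (M.eRk ((p.1 ∪ p.2 : Finset α) : Set α)).toNat = (M.eRk (p.1 : Set α)).toNat + δ)).image
        (fun p : (Σ _ : Finset α, Finset α) => (⟨gr M \ (p.1 ∪ p.2), p.2⟩ : Σ _ : Finset α, Finset α)))
    (hφinj : ∀ lo hi δ : ℕ, Set.InjOn (φ lo hi δ)
      ((((gr M).powerset.filter (fun I : Finset α => lo ≤ (M.eRk (I : Set α)).toNat ∧
        (M.eRk (I : Set α)).toNat ≤ hi ∧ hi + δ + 1 ≤ (M.eRk ((gr M \ I : Finset α) : Set α)).toNat)).sigma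
        (fun I : Finset α => powersetCard δ (K (gr M \ I)))).filter
        (fun p => ¬ ((M.eRk ((p.1 ∪ p.2 : Finset α) : Set α)).toNat = (M.eRk (p.1 : Set α)).toNat + δ)) :
        Set (Σ _ : Finset α, Finset α))) :
    ∀ lo hi δ Θ : ℕ, Θ ≤ lo + hi + δ → (lo = 0 ∨ lo + hi + δ ≤ Θ) →
      (∑ I ∈ (gr M).powerset, (if lo ≤ (M.eRk (I : Set α)).toNat ∧ (M.eRk (I : Set α)).toNat ≤ hi ∧
          Θ ≤ (M.eRk ((gr M \ I : Finset α) : Set α)).toNat + (M.eRk (I : Set α)).toNat then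
          ((M.eRk ((gr M \ I : Finset α) : Set α)).toNat).choose δ else 0)) ≤
        ∑ I ∈ (gr M).powerset, (if lo + δ ≤ (M.eRk ((gr M \ I : Finset α) : Set α)).toNat ∧
          (M.eRk ((gr M \ I : Finset α) : Set α)).toNat ≤ hi + δ then
          ((M.eRk ((gr M \ I : Finset α) : Set α)).toNat).choose δ else 0) :=
  pld_of_card_residual_le_all M K hK
    (fun lo hi δ => card_residual_le_of_bad_inj M K hK lo hi δ (φ lo hi δ) (hφ lo hi δ) (hφinj lo hi δ))

end PavingPLD

end PercRepro
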